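import Literature.Claims.NS.Shlygin2026
import Literature.Analysis.FluidPDE.LocalAffineChainRules
import Literature.Analysis.Calculus.MixedPartialBound
import HarnessLib

/-!
# NS-claims map, C151 (Shlygin 2026), tools for the Thm 2.7 twin: calculus on a closed slab and the
# space-time pull-back onto the Escauriaza–Seregin–Šverák half-space domain

Support file (part 1 of 2) for `SoloSalvageShlygin2026.lean`, which derives the typed Theorem 2.7 of
claim C151 (`Literature.Claims.NS.Shlygin2026.Theorem27_BackwardUniqueness`: whole-space backward
uniqueness for `∂ₜv − νΔv + b·∇v + cv = 0` with bounded coefficients under Gaussian growth) from the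
tree's PROVED half-space theorem `Literature.Analysis.FluidPDE.ess_backward_uniqueness_holds`
(Escauriaza–Seregin–Šverák 2003 Thm. 5.1 = Seregin 2014 Thm. A.3.5).  Here:

* calculus for a field `v` that is jointly `C²` on the CLOSED slab `[t₁, t₂] × ℝ³` (the typed
  hypothesis): interior `C²`-ness, `C²` slices, differentiability in time, the one-sided time
  derivative within the slab equals the two-sided one at interior times, the time derivative and
  the slice Hessian are bounded by the joint derivatives within the slab
  (`norm_timeDeriv_le`, `norm_iteratedFDeriv_two_slice_le`, via the tree's
  `deriv_slice_left_eq_fderiv` / `norm_iteratedFDeriv_slice_right_le`), hence bounded on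
  `(t₁, t₂) × B̄(x₀, R)` (`exists_bounds_on_closedBall`), and continuity at the left endpoint
  (`eq_zero_left_endpoint`);
* the normalised pull-back `u = C⁻¹ • stPull (−α) β t₂ x₀ v`, `u(s, y) = C⁻¹ v(t₂ − α s, x₀ + β y)`
  (the tree's `stPull`), its joint `C²`-ness on `[0,1] × ℝ³` and its derivatives at interior points
  (`timeDeriv_pull`, `fderiv_pull`, `laplacian_pull`, `norm_iteratedFDeriv_two_pull_le`, from the
  tree's `timeDeriv_stPull`, `fderiv_stPull`, `laplacian_comp_affine_of_contDiffOn`,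
  `norm_iteratedFDeriv_two_comp_affine_le`).

Salvage seat ns-claims-salvage-p4 g4 (chair RULINGS 2026-08-27 11:31Z (3)).  Axioms: `propext`,
`Classical.choice`, `Quot.sound` only.
WHAT THIS IS NOT: not a claim about NS regularity or blow-up; not a claim about any author beyond
the typed locator.
-/

noncomputable section

open MeasureTheory Set Filter Function Metric
open scoped ENNReal NNReal Topology RealInnerProductSpace InnerProductSpace Laplacian

-- The summit's canonical theorem namespace repeats the summit name (single-conjunct summit).
set_option linter.dupNamespace false

namespace Summit.NavierStokesRegularity.NavierStokesRegularity.Theorems.Shlygin2026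

open Literature.Analysis.FluidPDE Literature.Claims.NS.Shlygin2026
open Literature.Analysis.Calculus

/-! ## Calculus on the closed slab `[t₁, t₂] × ℝ³` -/

section Slab

variable {v : ℝ → E3 → E3} {t₁ t₂ : ℝ}

/-- The closed slab is a set of unique differentiability (`t₁ < t₂`). [folklore] -/
theorem uniqueDiffOn_slab (ht : t₁ < t₂) : UniqueDiffOn ℝ (Icc t₁ t₂ ×ˢ (univ : Set E3)) :=
  (uniqueDiffOn_Icc ht).prod uniqueDiffOn_univ

/-- At an interior time the closed slab is a neighbourhood. [folklore] -/
theorem slab_mem_nhds {t : ℝ} (ht : t ∈ Ioo t₁ t₂) (x : E3) :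
    Icc t₁ t₂ ×ˢ (univ : Set E3) ∈ 𝓝 ((t, x) : ℝ × E3) :=
  prod_mem_nhds (Icc_mem_nhds ht.1 ht.2) univ_mem

/-- A jointly `C²` field on the closed slab is `C²` at every interior point. [folklore] -/
theorem contDiffAt_of_slab (h : ContDiffOn ℝ 2 (uncurry v) (Icc t₁ t₂ ×ˢ univ)) {t : ℝ}
    (ht : t ∈ Ioo t₁ t₂) (x : E3) : ContDiffAt ℝ 2 (uncurry v) (t, x) :=
  (h (t, x) ⟨Ioo_subset_Icc_self ht, mem_univ _⟩).contDiffAt (slab_mem_nhds ht x)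

/-- Slices of a jointly `C²` field on the closed slab are `C²` (every `t ∈ [t₁, t₂]`). [folklore] -/
theorem contDiff_slice (h : ContDiffOn ℝ 2 (uncurry v) (Icc t₁ t₂ ×ˢ univ)) {t : ℝ}
    (ht : t ∈ Icc t₁ t₂) : ContDiff ℝ 2 (v t) := by
  have hc : ContDiff ℝ 2 (fun x : E3 => ((t, x) : ℝ × E3)) := contDiff_const.prodMk contDiff_id
  have := h.comp_contDiff hc (fun x => ⟨ht, mem_univ x⟩)
  simpa [Function.comp_def] using this

/-- The time line `s ↦ v s x` is differentiable at interior times. [folklore] -/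
theorem differentiableAt_time (h : ContDiffOn ℝ 2 (uncurry v) (Icc t₁ t₂ ×ˢ univ)) {t : ℝ}
    (ht : t ∈ Ioo t₁ t₂) (x : E3) : DifferentiableAt ℝ (fun s => v s x) t := by
  have h1 : DifferentiableAt ℝ (uncurry v) (t, x) := (contDiffAt_of_slab h ht x).differentiableAt (by simp)
  have h2 : DifferentiableAt ℝ (fun s : ℝ => ((s, x) : ℝ × E3)) t :=
    (differentiableAt_id.prodMk (differentiableAt_const x))
  exact h1.comp t h2

/-- At interior times the one-sided time derivative within the slab is the two-sided one. [folklore] -/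
theorem timeDerivWithin_eq_timeDeriv {t : ℝ} (ht : t ∈ Ioo t₁ t₂) (x : E3) :
    timeDerivWithin (Icc t₁ t₂) v t x = timeDeriv v t x := by
  rw [timeDerivWithin, timeDeriv_apply, derivWithin_of_mem_nhds (Icc_mem_nhds ht.1 ht.2)]

/-- At interior times the time derivative is the joint derivative in the direction `(1, 0)`, hence
bounded by the norm of the joint derivative within the slab. [folklore] -/
theorem norm_timeDeriv_le (h : ContDiffOn ℝ 2 (uncurry v) (Icc t₁ t₂ ×ˢ univ)) {t : ℝ}
    (ht : t ∈ Ioo t₁ t₂) (x : E3) :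
    ‖timeDeriv v t x‖ ≤ ‖fderivWithin ℝ (uncurry v) (Icc t₁ t₂ ×ˢ univ) (t, x)‖ := by
  have hd : DifferentiableAt ℝ (uncurry v) (t, x) := (contDiffAt_of_slab h ht x).differentiableAt (by simp)
  rw [timeDeriv_apply, show (fun s => v s x) = fun s => uncurry v (s, x) from rfl,
    deriv_slice_left_eq_fderiv hd, ← fderivWithin_of_mem_nhds (slab_mem_nhds ht x)]
  refine (ContinuousLinearMap.le_opNorm _ _).trans ?_
  have : ‖((1 : ℝ), (0 : E3))‖ ≤ 1 := by simp [Prod.norm_def]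
  calc ‖fderivWithin ℝ (uncurry v) (Icc t₁ t₂ ×ˢ univ) (t, x)‖ * ‖((1 : ℝ), (0 : E3))‖
      ≤ ‖fderivWithin ℝ (uncurry v) (Icc t₁ t₂ ×ˢ univ) (t, x)‖ * 1 :=
        mul_le_mul_of_nonneg_left this (norm_nonneg _)
    _ = _ := mul_one _

/-- At interior times the slice Hessian is bounded by the joint second derivative within the slab.
[folklore] -/
theorem norm_iteratedFDeriv_two_slice_le (h : ContDiffOn ℝ 2 (uncurry v) (Icc t₁ t₂ ×ˢ univ))
    {t : ℝ} (ht : t ∈ Ioo t₁ t₂) (x : E3) :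
    ‖iteratedFDeriv ℝ 2 (v t) x‖ ≤
      ‖iteratedFDerivWithin ℝ 2 (uncurry v) (Icc t₁ t₂ ×ˢ univ) (t, x)‖ := by
  have hopen : ContDiffOn ℝ 2 (uncurry v) (Ioo t₁ t₂ ×ˢ univ) :=
    h.mono (prod_mono Ioo_subset_Icc_self le_rfl)
  have h1 := norm_iteratedFDeriv_slice_right_le (g := uncurry v) isOpen_Ioo hopen ht
    (i := 2) le_rfl x
  have h2 : iteratedFDeriv ℝ 2 (uncurry v) (t, x) =
      iteratedFDerivWithin ℝ 2 (uncurry v) (Icc t₁ t₂ ×ˢ univ) (t, x) := by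
    rw [← iteratedFDerivWithin_univ]
    refine iteratedFDerivWithin_congr_set ?_ 2
    exact (Filter.eventuallyEq_univ.mpr (slab_mem_nhds ht x)).symm
  have h3 : (fun ξ => uncurry v (t, ξ)) = v t := rfl
  rw [h3] at h1
  rw [← h2]; exact h1

/-- **Uniform bounds on bounded parts of the closed slab**: `|v|`, `|∂ₜv|` (interior times) and
`|∇²v(t,·)|` (interior times) are bounded on `[t₁, t₂] × B̄(x₀, R)`. [folklore] -/
theorem exists_bounds_on_closedBall (h : ContDiffOn ℝ 2 (uncurry v) (Icc t₁ t₂ ×ˢ univ))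
    (ht : t₁ < t₂) (x₀ : E3) (R : ℝ) :
    ∃ B : ℝ, 0 ≤ B ∧ ∀ t ∈ Ioo t₁ t₂, ∀ x ∈ closedBall x₀ R,
      ‖v t x‖ ≤ B ∧ ‖timeDeriv v t x‖ ≤ B ∧ ‖iteratedFDeriv ℝ 2 (v t) x‖ ≤ B := by
  set S : Set (ℝ × E3) := Icc t₁ t₂ ×ˢ closedBall x₀ R with hS
  have hSc : IsCompact S := isCompact_Icc.prod (isCompact_closedBall x₀ R)
  have hSsub : S ⊆ Icc t₁ t₂ ×ˢ univ := prod_mono le_rfl (subset_univ _)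
  have hU := uniqueDiffOn_slab ht
  -- the three continuous functions on the closed slab
  have hc0 : ContinuousOn (uncurry v) S := h.continuousOn.mono hSsub
  have hc1 : ContinuousOn (fderivWithin ℝ (uncurry v) (Icc t₁ t₂ ×ˢ univ)) S :=
    (h.continuousOn_fderivWithin hU (by norm_num)).mono hSsub
  have hc2 : ContinuousOn (iteratedFDerivWithin ℝ 2 (uncurry v) (Icc t₁ t₂ ×ˢ univ)) S :=
    (h.continuousOn_iteratedFDerivWithin le_rfl hU).mono hSsub
  obtain ⟨B₀, hB₀⟩ := hSc.exists_bound_of_continuousOn hc0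
  obtain ⟨B₁, hB₁⟩ := hSc.exists_bound_of_continuousOn hc1
  obtain ⟨B₂, hB₂⟩ := hSc.exists_bound_of_continuousOn hc2
  refine ⟨max (max B₀ B₁) (max B₂ 0), le_max_of_le_right (le_max_right _ _), fun t htI x hx => ?_⟩
  have hz : ((t, x) : ℝ × E3) ∈ S := ⟨Ioo_subset_Icc_self htI, hx⟩
  refine ⟨?_, ?_, ?_⟩
  · exact (hB₀ _ hz).trans (le_max_of_le_left (le_max_left _ _))
  · exact ((norm_timeDeriv_le h htI x).trans (hB₁ _ hz)).trans
      (le_max_of_le_left (le_max_right _ _))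
  · exact ((norm_iteratedFDeriv_two_slice_le h htI x).trans (hB₂ _ hz)).trans
      (le_max_of_le_right (le_max_left _ _))

/-- Continuity in time at the left endpoint: if `v(t, x) = 0` for all `t ∈ (t₁, t₂)` then
`v(t₁, x) = 0`. [folklore] -/
theorem eq_zero_left_endpoint (h : ContDiffOn ℝ 2 (uncurry v) (Icc t₁ t₂ ×ˢ univ)) (ht : t₁ < t₂)
    (x : E3) (hzero : ∀ t ∈ Ioo t₁ t₂, v t x = 0) : v t₁ x = 0 := by
  have hline : ContinuousOn (fun t => v t x) (Icc t₁ t₂) := by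
    have hc : Continuous (fun t : ℝ => ((t, x) : ℝ × E3)) := continuous_id.prodMk continuous_const
    exact h.continuousOn.comp hc.continuousOn (fun t htI => ⟨htI, mem_univ x⟩)
  have h1 : Tendsto (fun t => v t x) (𝓝[Ioo t₁ t₂] t₁) (𝓝 (v t₁ x)) :=
    ((hline t₁ (left_mem_Icc.mpr ht.le)).mono Ioo_subset_Icc_self).tendsto
  have h2 : Tendsto (fun t => v t x) (𝓝[Ioo t₁ t₂] t₁) (𝓝 0) :=
    tendsto_const_nhds.congr' (eventually_nhdsWithin_of_forall fun t htI => (hzero t htI).symm)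
  haveI : (𝓝[Ioo t₁ t₂] t₁).NeBot := left_nhdsWithin_Ioo_neBot ht
  exact tendsto_nhds_unique h1 h2

end Slab

/-! ## The pulled-back field on ESS's half-space domain -/

section Pull

variable {ν : ℝ} {t₁ t₂ : ℝ} {v b : ℝ → E3 → E3} {c : ℝ → E3 → E3 →L[ℝ] E3}

/-- The pulled-back, normalised field `u = C⁻¹ • stPull (−α) β t₂ x₀ v`, pointwise:
`u(s, y) = C⁻¹ v(t₂ − α s, x₀ + β y)`. [folklore] -/
theorem pull_apply (C α β t₂ : ℝ) (x₀ : E3) (v : ℝ → E3 → E3) (s : ℝ) (y : E3) :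
    (C⁻¹ • stPull (-α) β t₂ x₀ v) s y = C⁻¹ • v (t₂ + -α * s) (x₀ + β • y) := rfl

/-- The time map `s ↦ t₂ − α s` sends `(0, 1)` into `(t₁, t₂)` (`α = t₂ − t₁ > 0`). [folklore] -/
theorem time_mem_Ioo (ht : t₁ < t₂) {s : ℝ} (hs : s ∈ Ioo (0 : ℝ) 1) :
    t₂ + -(t₂ - t₁) * s ∈ Ioo t₁ t₂ := by
  constructor <;> nlinarith [hs.1, hs.2]

/-- The time map sends `[0, 1]` into `[t₁, t₂]`. [folklore] -/
theorem time_mem_Icc (ht : t₁ < t₂) {s : ℝ} (hs : s ∈ Icc (0 : ℝ) 1) :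
    t₂ + -(t₂ - t₁) * s ∈ Icc t₁ t₂ := by
  constructor <;> nlinarith [hs.1, hs.2]

/-- The pulled-back field is jointly `C²` on the closed unit slab. [folklore] -/
theorem contDiffOn_pull (h : ContDiffOn ℝ 2 (uncurry v) (Icc t₁ t₂ ×ˢ univ)) (ht : t₁ < t₂)
    (C β : ℝ) (x₀ : E3) :
    ContDiffOn ℝ 2 (uncurry ((C⁻¹ • stPull (-(t₂ - t₁)) β t₂ x₀ v))) (Icc (0 : ℝ) 1 ×ˢ univ) := by
  have hΦ : ContDiff ℝ 2 (fun z : ℝ × E3 => ((t₂ + -(t₂ - t₁) * z.1, x₀ + β • z.2) : ℝ × E3)) := by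
    fun_prop
  have hmaps : MapsTo (fun z : ℝ × E3 => ((t₂ + -(t₂ - t₁) * z.1, x₀ + β • z.2) : ℝ × E3))
      (Icc (0 : ℝ) 1 ×ˢ univ) (Icc t₁ t₂ ×ˢ univ) := fun z hz => ⟨time_mem_Icc ht hz.1, mem_univ _⟩
  have hcomp := (h.comp hΦ.contDiffOn hmaps).const_smul C⁻¹
  refine hcomp.congr fun z _ => ?_
  simp [stPull, uncurry]

/-- The pulled-back field is continuous on `[0, 1) × ℝ³`. [folklore] -/
theorem continuousOn_pull (h : ContDiffOn ℝ 2 (uncurry v) (Icc t₁ t₂ ×ˢ univ)) (ht : t₁ < t₂)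
    (C β : ℝ) (x₀ : E3) (H : Set E3) :
    ContinuousOn (uncurry ((C⁻¹ • stPull (-(t₂ - t₁)) β t₂ x₀ v))) (Ico (0 : ℝ) 1 ×ˢ H) :=
  (contDiffOn_pull h ht C β x₀).continuousOn.mono (prod_mono Ico_subset_Icc_self (subset_univ _))

end Pull

/-! ## Pointwise identities for the pulled-back field -/

section Identities

variable {t₁ t₂ : ℝ} {v : ℝ → E3 → E3}

/-- `∂ₛ(c • ψ) = c • ∂ₛψ` at points of differentiability in time. [folklore] -/
theorem timeDeriv_const_smul' {ψ : ℝ → E3 → E3} (k : ℝ) {s : ℝ} {y : E3}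
    (h : DifferentiableAt ℝ (fun r => ψ r y) s) :
    timeDeriv (k • ψ) s y = k • timeDeriv ψ s y := by
  simp only [timeDeriv_apply, Pi.smul_apply]
  exact deriv_const_smul k h

/-- Time derivative of the pulled-back field at an interior time. [folklore] -/
theorem timeDeriv_pull (h : ContDiffOn ℝ 2 (uncurry v) (Icc t₁ t₂ ×ˢ univ)) (ht : t₁ < t₂)
    (C β : ℝ) (x₀ : E3) {s : ℝ} (hs : s ∈ Ioo (0 : ℝ) 1) (y : E3) :
    timeDeriv ((C⁻¹ • stPull (-(t₂ - t₁)) β t₂ x₀ v)) s y =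
      (C⁻¹ * -(t₂ - t₁)) • timeDeriv v (t₂ + -(t₂ - t₁) * s) (x₀ + β • y) := by
  have hT := time_mem_Ioo ht hs
  have hd : DifferentiableAt ℝ (fun r => stPull (-(t₂ - t₁)) β t₂ x₀ v r y) s := by
    show DifferentiableAt ℝ (fun r => v (t₂ + -(t₂ - t₁) * r) (x₀ + β • y)) s
    have h1 := differentiableAt_time h hT (x₀ + β • y)
    have h2 : DifferentiableAt ℝ (fun r : ℝ => t₂ + -(t₂ - t₁) * r) s := by fun_prop
    exact h1.comp s h2
  rw [timeDeriv_const_smul' C⁻¹ hd, timeDeriv_stPull, smul_smul]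

/-- Spatial gradient of the pulled-back field. [folklore] -/
theorem fderiv_pull (h : ContDiffOn ℝ 2 (uncurry v) (Icc t₁ t₂ ×ˢ univ)) (ht : t₁ < t₂)
    (C β : ℝ) (x₀ : E3) {s : ℝ} (hs : s ∈ Ioo (0 : ℝ) 1) (y : E3) :
    fderiv ℝ ((C⁻¹ • stPull (-(t₂ - t₁)) β t₂ x₀ v) s) y =
      (C⁻¹ * β) • fderiv ℝ (v (t₂ + -(t₂ - t₁) * s)) (x₀ + β • y) := by
  have hT := time_mem_Ioo ht hs
  have hv : ContDiff ℝ 2 (v (t₂ + -(t₂ - t₁) * s)) := contDiff_slice h (Ioo_subset_Icc_self hT)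
  have hd : DifferentiableAt ℝ (stPull (-(t₂ - t₁)) β t₂ x₀ v s) y := by
    show DifferentiableAt ℝ (fun z => v (t₂ + -(t₂ - t₁) * s) (x₀ + β • z)) y
    have h1 : DifferentiableAt ℝ (v (t₂ + -(t₂ - t₁) * s)) (x₀ + β • y) :=
      (hv.differentiable (by simp)).differentiableAt
    have h2 : DifferentiableAt ℝ (fun z : E3 => x₀ + β • z) y := by fun_prop
    exact h1.comp y h2
  have e1 : (C⁻¹ • stPull (-(t₂ - t₁)) β t₂ x₀ v) s = C⁻¹ • stPull (-(t₂ - t₁)) β t₂ x₀ v s := rfl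
  rw [e1, fderiv_const_smul hd, fderiv_stPull, smul_smul]

/-- Laplacian of the pulled-back field. [folklore] -/
theorem laplacian_pull (h : ContDiffOn ℝ 2 (uncurry v) (Icc t₁ t₂ ×ˢ univ)) (ht : t₁ < t₂)
    (C β : ℝ) (x₀ : E3) {s : ℝ} (hs : s ∈ Ioo (0 : ℝ) 1) (y : E3) :
    (Δ ((C⁻¹ • stPull (-(t₂ - t₁)) β t₂ x₀ v) s)) y =
      (C⁻¹ * β ^ 2) • (Δ (v (t₂ + -(t₂ - t₁) * s))) (x₀ + β • y) := by
  have hT := time_mem_Ioo ht hs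
  set T := t₂ + -(t₂ - t₁) * s with hTdef
  have hv : ContDiff ℝ 2 (v T) := contDiff_slice h (Ioo_subset_Icc_self hT)
  have hcv : ContDiffOn ℝ 2 (fun w => C⁻¹ • v T w) univ := (hv.const_smul C⁻¹).contDiffOn
  have e1 : (C⁻¹ • stPull (-(t₂ - t₁)) β t₂ x₀ v) s = fun z => (fun w => C⁻¹ • v T w) (x₀ + β • z) := by
    funext z; rfl
  rw [e1, laplacian_comp_affine_of_contDiffOn hcv isOpen_univ x₀ β (mem_univ _)]
  have e2 : (fun w => C⁻¹ • v T w) = (C⁻¹ • ContinuousLinearMap.id ℝ E3) ∘ v T := by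
    funext w; simp
  rw [e2, ContDiffAt.laplacian_CLM_comp_left hv.contDiffAt]
  simp [smul_smul, mul_comm]

/-- Hessian bound for the pulled-back field. [folklore] -/
theorem norm_iteratedFDeriv_two_pull_le (h : ContDiffOn ℝ 2 (uncurry v) (Icc t₁ t₂ ×ˢ univ))
    (ht : t₁ < t₂) {C : ℝ} (hC : 0 < C) (β : ℝ) (x₀ : E3) {s : ℝ} (hs : s ∈ Ioo (0 : ℝ) 1) (y : E3) :
    ‖iteratedFDeriv ℝ 2 ((C⁻¹ • stPull (-(t₂ - t₁)) β t₂ x₀ v) s) y‖ ≤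
      C⁻¹ * β ^ 2 * ‖iteratedFDeriv ℝ 2 (v (t₂ + -(t₂ - t₁) * s)) (x₀ + β • y)‖ := by
  have hT := time_mem_Ioo ht hs
  set T := t₂ + -(t₂ - t₁) * s with hTdef
  have hv : ContDiff ℝ 2 (v T) := contDiff_slice h (Ioo_subset_Icc_self hT)
  have hcomp : ContDiff ℝ 2 (fun z : E3 => v T (x₀ + β • z)) := hv.comp (by fun_prop)
  have e1 : (C⁻¹ • stPull (-(t₂ - t₁)) β t₂ x₀ v) s = fun z => C⁻¹ • (fun z : E3 => v T (x₀ + β • z)) z := by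
    funext z; rfl
  rw [e1, iteratedFDeriv_const_smul_apply' hcomp.contDiffAt, norm_smul, Real.norm_eq_abs,
    abs_of_pos (inv_pos.2 hC), mul_assoc]
  refine mul_le_mul_of_nonneg_left ?_ (inv_pos.2 hC).le
  exact norm_iteratedFDeriv_two_comp_affine_le hv.contDiffOn isOpen_univ x₀ β (mem_univ _)

end Identities

end Summit.NavierStokesRegularity.NavierStokesRegularity.Theorems.Shlygin2026

end
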